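import Mathlib

/-!
# Route `FilamentSkeletonRss` · ∀-crux `TransverseReduction1AR` (stmt-NavierStokesRegularity-23611) · R8 (LEAD g13): the AREA-CHANGE MODE of a strained Gaussian core is a
# TOTAL DERIVATIVE in the radial flux variable — ZERO sectional mass, explicit bounded zero-mass corrector, Burgers balance — i.e. it lives in the polynomially invertible
# m = 0 class of `radialBlock_apriori`, NOT on the accretion (mass-source) direction

Helper file (theorems only), `--supports stmt-NavierStokesRegularity-23611 --as helper`; LEAD of 23611, lane ns-filament-21221-p1 g13; director-ns dss_125 (3) «land R8's
kernel-checkable cores; negative knowledge is bankable whatever the verdict».  R8 (`Cruxes/TransverseReductionRJ/Lines/defect_column_gate_1AR_acc_R8.md`): the «A1R-acc»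
design exported an affine AREA LAW into the accretion multiplier (`Γ·|B_j − k·F⁰| ≤ Ce`, `k ≥ k₀ > 0`); but the residual that a rigid Gaussian core of the WRONG area leaves in
the m = 0 radial block is the derivative of the radial flux — zero sectional mass at every station, corrected by an explicit BOUNDED zero-mass profile (the difference of two
unit-mass Gaussians), with no solvability condition — whereas the accretion multiplier sits on the near-cokernel MASS-SOURCE direction.  In the 1-D dictionary of the landed
m = 0 block (`Theorems/…DefectColumnGateRadialBlock.lean`, `radialBlock_apriori`: variable `u = r²`, flux `Φ(u) = 4u·w′(u) + γ·u·w(u)`, operator `Φ′ = f`, data class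
`∫₀^∞ w = 0`, `(1+u)²|f| ≤ M`):

* `gaussCore A u = e^{−u/A}/(πA)` — the unit-mass Gaussian core of «area» `A` (`∫₀^∞ gaussCore A = 1/π` for every `A > 0`, `integral_gaussCore`);
* `hasDerivAt_radialFlux_gaussCore` — its flux is `Φ_A(u) = (γ − 4/A)·u·w_A(u)` and the RESIDUAL `Φ_A′(u) = (γ − 4/A)(1 − u/A)·w_A(u)` (`radialDefect`);
* `radialDefect_eq_areaMode` — `Φ_A′ = (4 − γA)·∂_A w_A`: the wrong-area residual IS the area-change mode (`hasDerivAt_gaussCore_area`);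
* `radialDefect_eq_zero_iff` — it vanishes identically iff `A = A* := 4/γ` (Burgers balance; the route's `F⁰ = (3/2 − w′)A + 4 = 0` with `γ ↔ w′ − 3/2`);
* `integral_radialDefect` — `∫₀^∞ Φ_A′ = 0`: ZERO SECTIONAL MASS for every `A` (total derivative, `Φ_A(0) = 0`, `Φ_A(∞) = 0`);
* `corrector_flux`, `integral_corrector`, `corrector_bound` — the explicit corrector `w := w_A − w_{A*}` has flux `4u·w′ + γu·w = Φ_A` (so `(flux)′ =` the residual), ZERO MASS,
  and `(1+u)²|w| ≤ (1 + 2·max A A*)²·(1/(πA) + 1/(πA*))` — it is in `radialBlock_apriori`'s class: the core RELAXES to the Burgers area at order one, and nothing reaches the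
  mass-source (accretion) direction.

HONEST FRAMING: elementary calculus recording a NEGATIVE design finding about a HYPOTHETICAL blow-up route (MODEL rung, negative side); nothing here bears on Navier–Stokes
regularity; no item is proved or refuted by this file.
-/

set_option linter.dupNamespace false

noncomputable section

namespace Summit.NavierStokesRegularity.NavierStokesRegularity.Theorems.DefectColumnGate

open Set Filter MeasureTheory Topology Real

/-! ## The Gaussian core in the variable `u = r²` -/

/-- The unit-mass Gaussian core of «area» `A` in the variable `u = r²`: `w_A(u) = e^{−u/A}/(πA)`. -/
def gaussCore (A u : ℝ) : ℝ := Real.exp (-u / A) / (Real.pi * A)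

/-- `w_A` is positive for `A > 0`. -/
theorem gaussCore_pos {A : ℝ} (hA : 0 < A) (u : ℝ) : 0 < gaussCore A u := by
  unfold gaussCore; positivity

/-- `∂_u w_A = −w_A/A`. -/
theorem hasDerivAt_gaussCore (A u : ℝ) : HasDerivAt (gaussCore A) (-(1 / A) * gaussCore A u) u := by
  unfold gaussCore
  have h1 : HasDerivAt (fun s : ℝ => -s / A) (-(1 / A)) u := by
    have := (hasDerivAt_id u).neg.div_const A
    simpa [neg_div, one_div, div_eq_mul_inv] using this
  have h2 : HasDerivAt (fun s : ℝ => Real.exp (-s / A)) (Real.exp (-u / A) * (-(1 / A))) u := h1.exp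
  have h3 := h2.div_const (Real.pi * A)
  exact h3.congr_deriv (by ring)

/-- **The area-change mode**: `∂_A w_A(u) = (u/A² − 1/A)·w_A(u)`. -/
theorem hasDerivAt_gaussCore_area {A : ℝ} (hA : A ≠ 0) (u : ℝ) :
    HasDerivAt (fun B : ℝ => gaussCore B u) ((u / A ^ 2 - 1 / A) * gaussCore A u) A := by
  unfold gaussCore
  have hπA : Real.pi * A ≠ 0 := mul_ne_zero Real.pi_ne_zero hA
  -- `B ↦ −u/B` has derivative `u/A²`
  have h1 : HasDerivAt (fun B : ℝ => -u / B) (u / A ^ 2) A := by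
    have h := (hasDerivAt_inv hA).const_mul (-u)
    have e : (fun B : ℝ => -u * B⁻¹) = fun B => -u / B := by funext B; rw [div_eq_mul_inv]
    rw [e] at h
    exact h.congr_deriv (by rw [div_eq_mul_inv]; ring)
  have h2 : HasDerivAt (fun B : ℝ => Real.exp (-u / B)) (Real.exp (-u / A) * (u / A ^ 2)) A := h1.exp
  have h3 : HasDerivAt (fun B : ℝ => Real.pi * B) (Real.pi * 1) A := (hasDerivAt_id A).const_mul Real.pi
  have h4 := h2.div h3 hπA
  refine h4.congr_deriv ?_
  field_simp

/-! ## The wrong-area residual in the m = 0 radial block -/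

/-- The radial flux of `w_A`: `4u·w_A′(u) + γ·u·w_A(u) = (γ − 4/A)·u·w_A(u)`. -/
theorem radialFlux_gaussCore (γ A u : ℝ) : 4 * u * (-(1 / A) * gaussCore A u) + γ * u * gaussCore A u = (γ - 4 / A) * u * gaussCore A u := by
  ring

/-- **The residual of a rigid Gaussian core of area `A` in the m = 0 block**: `(4u·w_A′ + γu·w_A)′(u) = (γ − 4/A)(1 − u/A)·w_A(u)`. -/
theorem hasDerivAt_radialFlux_gaussCore (A γ u : ℝ) :
    HasDerivAt (fun s : ℝ => (γ - 4 / A) * s * gaussCore A s) ((γ - 4 / A) * (1 - u / A) * gaussCore A u) u := by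
  have h := ((hasDerivAt_id u).const_mul (γ - 4 / A)).mul (hasDerivAt_gaussCore A u)
  have e : (fun s : ℝ => (γ - 4 / A) * s * gaussCore A s) = (fun y : ℝ => (γ - 4 / A) * id y) * gaussCore A := by
    funext s; simp only [Pi.mul_apply, id]
  rw [e]
  exact h.congr_deriv (by simp only [id]; ring)

/-- The residual, as a function. -/
def radialDefect (γ A u : ℝ) : ℝ := (γ - 4 / A) * (1 - u / A) * gaussCore A u

/-- **The residual IS the area-change mode**: `(γ − 4/A)(1 − u/A)·w_A = (4 − γA)·∂_A w_A`. -/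
theorem radialDefect_eq_areaMode {A : ℝ} (hA : A ≠ 0) (γ u : ℝ) :
    radialDefect γ A u = (4 - γ * A) * ((u / A ^ 2 - 1 / A) * gaussCore A u) := by
  unfold radialDefect
  field_simp
  ring

/-- **Burgers balance**: the residual vanishes identically iff `A = 4/γ` (`A, γ > 0`). -/
theorem radialDefect_eq_zero_iff {A γ : ℝ} (hA : 0 < A) (hγ : 0 < γ) : (∀ u, radialDefect γ A u = 0) ↔ A = 4 / γ := by
  have hγ0 : γ ≠ 0 := hγ.ne'
  constructor
  · intro h
    have h0 := h 0
    unfold radialDefect at h0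
    simp only [zero_div, sub_zero, mul_one] at h0
    have hg : gaussCore A 0 ≠ 0 := (gaussCore_pos hA 0).ne'
    have h1 : γ - 4 / A = 0 := by
      rcases mul_eq_zero.mp h0 with h | h
      · exact h
      · exact absurd h hg
    have h2 : γ = 4 / A := sub_eq_zero.mp h1
    rw [h2]; field_simp
  · intro h u
    unfold radialDefect
    have : γ - 4 / A = 0 := by rw [h]; field_simp [hγ0]; ring
    rw [this]; ring

/-! ## Zero sectional mass and the explicit zero-mass corrector -/

/-- `∫₀^∞ e^{−u/A} du = A` for `A > 0`. -/
theorem integral_exp_neg_div {A : ℝ} (hA : 0 < A) : ∫ u in Ioi (0:ℝ), Real.exp (-u / A) = A := by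
  have ha : -(1 / A) < 0 := by rw [neg_lt_zero]; positivity
  have h := integral_exp_mul_Ioi ha 0
  have e : (fun u : ℝ => Real.exp (-(1 / A) * u)) = fun u => Real.exp (-u / A) := by
    funext u; congr 1; ring
  rw [e] at h
  rw [h]; simp only [mul_zero, Real.exp_zero]; field_simp

/-- `u ↦ e^{−u/A}` is integrable on `(0, ∞)` for `A > 0`. -/
theorem integrableOn_exp_neg_div {A : ℝ} (hA : 0 < A) : IntegrableOn (fun u : ℝ => Real.exp (-u / A)) (Ioi 0) := by
  have ha : -(1 / A) < 0 := by rw [neg_lt_zero]; positivity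
  have h := integrableOn_exp_mul_Ioi ha 0
  refine h.congr_fun (fun u _ => ?_) measurableSet_Ioi
  simp only; congr 1; ring

/-- **Unit mass**: `∫₀^∞ w_A = 1/π` for every `A > 0`. -/
theorem integral_gaussCore {A : ℝ} (hA : 0 < A) : ∫ u in Ioi (0:ℝ), gaussCore A u = 1 / Real.pi := by
  unfold gaussCore
  rw [integral_div, integral_exp_neg_div hA]
  field_simp

/-- `w_A` is integrable on `(0, ∞)`. -/
theorem integrableOn_gaussCore {A : ℝ} (hA : 0 < A) : IntegrableOn (gaussCore A) (Ioi 0) := by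
  unfold gaussCore
  simp_rw [div_eq_mul_inv (Real.exp _) (Real.pi * A)]
  exact (integrableOn_exp_neg_div hA).mul_const _

/-- **ZERO SECTIONAL MASS of the wrong-area residual**, for every `A > 0`: `∫₀^∞ (γ − 4/A)(1 − u/A)·w_A(u) du = 0` (total derivative of the flux `(γ − 4/A)·u·w_A(u)`, which
vanishes at `u = 0` and at infinity). -/
theorem integral_radialDefect {A : ℝ} (hA : 0 < A) (γ : ℝ) : ∫ u in Ioi (0:ℝ), radialDefect γ A u = 0 := by
  have hA0 : A ≠ 0 := hA.ne'
  -- integrability of the residual: `|1 − u/A|·e^{−u/A} ≤ 2e^{−u/(2A)}` is not needed exactly; dominate by a continuous integrable majorant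
  have hint : IntegrableOn (fun u : ℝ => radialDefect γ A u) (Ioi 0) := by
    -- `radialDefect = c₁·w_A + c₂·(u·w_A)` and `u·w_A(u) ≤ A·w_{2A}(u)·2`-type domination: use `u e^{−u/A} ≤ A e^{−u/(2A)}`... simplest: both pieces integrable
    have h1 : IntegrableOn (fun u : ℝ => (γ - 4 / A) * gaussCore A u) (Ioi 0) := (integrableOn_gaussCore hA).const_mul _
    have h2 : IntegrableOn (fun u : ℝ => u * gaussCore A u) (Ioi 0) := by
      -- `u e^{−u/A} ≤ 2A e^{−u/(2A)}` on `u ≥ 0`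
      have hdom : IntegrableOn (fun u : ℝ => 2 * A * Real.exp (-u / (2 * A)) / (Real.pi * A)) (Ioi 0) :=
        ((integrableOn_exp_neg_div (by positivity : 0 < 2 * A)).const_mul (2 * A)).div_const _
      refine hdom.mono' ?_ ?_
      · exact ((continuous_id.mul (by unfold gaussCore; fun_prop)).aestronglyMeasurable).restrict
      · refine (ae_restrict_iff' measurableSet_Ioi).mpr (Eventually.of_forall fun u hu => ?_)
        have hu0 : 0 ≤ u := le_of_lt hu
        unfold gaussCore
        rw [Real.norm_eq_abs, abs_of_nonneg (by positivity)]
        -- `u e^{−u/A} = u e^{−u/(2A)} e^{−u/(2A)} ≤ 2A e^{−u/(2A)}` since `x e^{−x/(2A)} ≤ 2A`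
        have hkey : u * Real.exp (-u / (2 * A)) ≤ 2 * A := by
          have h := Real.add_one_le_exp (u / (2 * A))
          have hpos : 0 < Real.exp (u / (2 * A)) := Real.exp_pos _
          have e : Real.exp (-u / (2 * A)) = (Real.exp (u / (2 * A)))⁻¹ := by rw [← Real.exp_neg]; congr 1; ring
          rw [e, ← div_eq_mul_inv, div_le_iff₀ hpos]
          have : u / (2 * A) * (2 * A) = u := by field_simp
          nlinarith [this, hA]
        have esplit : Real.exp (-u / A) = Real.exp (-u / (2 * A)) * Real.exp (-u / (2 * A)) := by
          rw [← Real.exp_add]; congr 1; field_simp; ring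
        rw [esplit]
        have hexp0 : 0 ≤ Real.exp (-u / (2 * A)) := (Real.exp_pos _).le
        have hπA : 0 < Real.pi * A := by positivity
        calc u * (Real.exp (-u / (2 * A)) * Real.exp (-u / (2 * A)) / (Real.pi * A))
            = (u * Real.exp (-u / (2 * A))) * Real.exp (-u / (2 * A)) / (Real.pi * A) := by ring
          _ ≤ (2 * A) * Real.exp (-u / (2 * A)) / (Real.pi * A) := by gcongr
          _ = 2 * A * Real.exp (-u / (2 * A)) / (Real.pi * A) := by ring
    have h3 : IntegrableOn (fun u : ℝ => -((γ - 4 / A) / A) * (u * gaussCore A u)) (Ioi 0) := h2.const_mul _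
    refine (h1.add h3).congr_fun (fun u _ => ?_) measurableSet_Ioi
    simp only [Pi.add_apply, radialDefect]; ring
  -- the flux and its limits
  have hderiv : ∀ u ∈ Ici (0:ℝ), HasDerivAt (fun s : ℝ => (γ - 4 / A) * s * gaussCore A s) (radialDefect γ A u) u :=
    fun u _ => hasDerivAt_radialFlux_gaussCore A γ u
  have hlim : Tendsto (fun s : ℝ => (γ - 4 / A) * s * gaussCore A s) atTop (𝓝 0) := by
    -- `s e^{−s/A} → 0`
    have h0 : Tendsto (fun s : ℝ => s * Real.exp (-s / A)) atTop (𝓝 0) := by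
      have h := (Real.tendsto_pow_mul_exp_neg_atTop_nhds_zero 1).comp (tendsto_id.atTop_mul_const (inv_pos.mpr hA))
      have e : (fun s : ℝ => s * Real.exp (-s / A)) = fun s => A * ((fun x : ℝ => x ^ 1 * Real.exp (-x)) ∘ (fun s => id s * A⁻¹)) s := by
        funext s
        simp only [Function.comp_apply, id, pow_one]
        rw [show -s / A = -(s * A⁻¹) by rw [div_eq_mul_inv, neg_mul]]
        field_simp
      rw [e]
      have := h.const_mul A
      rwa [mul_zero] at this
    have h1 := h0.const_mul ((γ - 4 / A) / (Real.pi * A))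
    rw [mul_zero] at h1
    refine h1.congr fun s => ?_
    unfold gaussCore; ring
  have h := integral_Ioi_of_hasDerivAt_of_tendsto' hderiv hint hlim
  rw [h]
  simp [gaussCore]

/-- **The explicit corrector's flux**: for `w := w_A − w_{A*}`, `A* = 4/γ`, the radial flux is `4u·w′ + γu·w = (γ − 4/A)·u·w_A` — so `(flux of w)′` is exactly the wrong-area
residual: the m = 0 block absorbs the residual by RELAXING THE CORE TO THE BURGERS AREA, at order one, with no solvability condition. -/
theorem corrector_flux {γ : ℝ} (hγ : γ ≠ 0) (A u : ℝ) :
    4 * u * (-(1 / A) * gaussCore A u - (-(1 / (4 / γ)) * gaussCore (4 / γ) u)) + γ * u * (gaussCore A u - gaussCore (4 / γ) u) =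
      (γ - 4 / A) * u * gaussCore A u := by
  have h4γ : (1 : ℝ) / (4 / γ) = γ / 4 := by field_simp
  rw [h4γ]; ring

/-- The corrector `w_A − w_{A*}` has the derivative used in `corrector_flux`. -/
theorem hasDerivAt_corrector (A γ u : ℝ) :
    HasDerivAt (fun s => gaussCore A s - gaussCore (4 / γ) s) (-(1 / A) * gaussCore A u - (-(1 / (4 / γ)) * gaussCore (4 / γ) u)) u :=
  (hasDerivAt_gaussCore A u).sub (hasDerivAt_gaussCore (4 / γ) u)

/-- **ZERO MASS of the corrector**: `∫₀^∞ (w_A − w_{A*}) = 0`. -/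
theorem integral_corrector {A γ : ℝ} (hA : 0 < A) (hγ : 0 < γ) : ∫ u in Ioi (0:ℝ), (gaussCore A u - gaussCore (4 / γ) u) = 0 := by
  have hA' : 0 < 4 / γ := by positivity
  rw [integral_sub (integrableOn_gaussCore hA) (integrableOn_gaussCore hA'), integral_gaussCore hA, integral_gaussCore hA', sub_self]

/-- `(1+u)²·e^{−u/A} ≤ (1 + 2A)²` on `u ≥ 0` (the weight of `radialBlock_apriori`'s class against a Gaussian core). -/
theorem weight_sq_mul_exp_le {A u : ℝ} (hA : 0 < A) (hu : 0 ≤ u) : (1 + u) ^ 2 * Real.exp (-u / A) ≤ (1 + 2 * A) ^ 2 := by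
  -- `(1+u) e^{−u/(2A)} ≤ 1 + 2A` because `e^{u/(2A)} ≥ 1 + u/(2A) ≥ (1+u)/(1+2A)`
  have hpos : 0 < Real.exp (u / (2 * A)) := Real.exp_pos _
  have h1 : (1 + u) ≤ (1 + 2 * A) * Real.exp (u / (2 * A)) := by
    have h := Real.add_one_le_exp (u / (2 * A))
    have : (1 + 2 * A) * (u / (2 * A) + 1) = 1 + 2 * A + u + u / (2 * A) := by field_simp; ring
    nlinarith [this, h, hu, hA, div_nonneg hu (by positivity : (0:ℝ) ≤ 2 * A)]
  have e : Real.exp (-u / A) = (Real.exp (u / (2 * A)))⁻¹ * (Real.exp (u / (2 * A)))⁻¹ := by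
    rw [← mul_inv, ← Real.exp_add, ← Real.exp_neg]; congr 1; field_simp; ring
  rw [e]
  have h2 : (1 + u) * (Real.exp (u / (2 * A)))⁻¹ ≤ 1 + 2 * A := by
    rw [← div_eq_mul_inv, div_le_iff₀ hpos]; exact h1
  have h3 : 0 ≤ (1 + u) * (Real.exp (u / (2 * A)))⁻¹ := by positivity
  calc (1 + u) ^ 2 * ((Real.exp (u / (2 * A)))⁻¹ * (Real.exp (u / (2 * A)))⁻¹)
      = ((1 + u) * (Real.exp (u / (2 * A)))⁻¹) * ((1 + u) * (Real.exp (u / (2 * A)))⁻¹) := by ring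
    _ ≤ (1 + 2 * A) * (1 + 2 * A) := mul_le_mul h2 h2 h3 (by positivity)
    _ = (1 + 2 * A) ^ 2 := by ring

/-- **The corrector is in `radialBlock_apriori`'s weighted class**: `(1+u)²|w_A(u) − w_{A*}(u)| ≤ (1+2A)²/(πA) + (1+2A*)²/(πA*)` on `u ≥ 0`. -/
theorem corrector_bound {A γ u : ℝ} (hA : 0 < A) (hγ : 0 < γ) (hu : 0 ≤ u) :
    (1 + u) ^ 2 * |gaussCore A u - gaussCore (4 / γ) u| ≤ (1 + 2 * A) ^ 2 / (Real.pi * A) + (1 + 2 * (4 / γ)) ^ 2 / (Real.pi * (4 / γ)) := by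
  have hA' : 0 < 4 / γ := by positivity
  have key : ∀ B : ℝ, 0 < B → (1 + u) ^ 2 * gaussCore B u ≤ (1 + 2 * B) ^ 2 / (Real.pi * B) := by
    intro B hB
    unfold gaussCore
    rw [show (1 + u) ^ 2 * (Real.exp (-u / B) / (Real.pi * B)) = ((1 + u) ^ 2 * Real.exp (-u / B)) / (Real.pi * B) by ring]
    exact div_le_div_of_nonneg_right (weight_sq_mul_exp_le hB hu) (by positivity)
  calc (1 + u) ^ 2 * |gaussCore A u - gaussCore (4 / γ) u| ≤ (1 + u) ^ 2 * (|gaussCore A u| + |gaussCore (4 / γ) u|) :=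
        mul_le_mul_of_nonneg_left (abs_sub _ _) (by positivity)
    _ = (1 + u) ^ 2 * gaussCore A u + (1 + u) ^ 2 * gaussCore (4 / γ) u := by
        rw [abs_of_pos (gaussCore_pos hA u), abs_of_pos (gaussCore_pos hA' u)]; ring
    _ ≤ _ := add_le_add (key A hA) (key (4 / γ) hA')

/-! ## Appendix (R8 §1(ii)): a committor PLATEAU sees a zero-mass mode only through its deviation from 1 -/

/-- **Zero-mass pairing bound.**  If `h` has zero mean (`∫ h = 0`) and the weight `q` is within `ε` of `1` wherever `h ≠ 0` (a committor-type PLATEAU over the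
support of the mode), then `|∫ q·h| ≤ ε·∫|h|`: the accretion functional pairs with the area-change mode only through `(1 − q)` on the core, which for the waist
committor is `O(e^{−cΓ})` (R8 §1(ii); the (δ) data's «ψ₀ plateau»).  Pure measure theory, any measure space. -/
theorem abs_integral_mul_le_of_plateau {X : Type*} [MeasurableSpace X] {μ : MeasureTheory.Measure X} {q h : X → ℝ} {ε : ℝ}
    (hh : Integrable h μ) (hqh : Integrable (fun x => q x * h x) μ) (hmean : ∫ x, h x ∂μ = 0)
    (hplat : ∀ x, h x ≠ 0 → |q x - 1| ≤ ε) :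
    |∫ x, q x * h x ∂μ| ≤ ε * ∫ x, |h x| ∂μ := by
  -- `∫ q h = ∫ (q − 1) h` because `∫ h = 0`
  have e : ∫ x, q x * h x ∂μ = ∫ x, (q x - 1) * h x ∂μ := by
    have h1 : (fun x => (q x - 1) * h x) = fun x => q x * h x - h x := by funext x; ring
    rw [h1, integral_sub hqh hh, hmean, sub_zero]
  rw [e]
  -- pointwise `|(q − 1) h| ≤ ε |h|`
  have hpt : ∀ x, ‖(q x - 1) * h x‖ ≤ ε * |h x| := by
    intro x
    rw [Real.norm_eq_abs, abs_mul]
    by_cases hx : h x = 0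
    · simp [hx]
    · exact mul_le_mul_of_nonneg_right (hplat x hx) (abs_nonneg _)
  have hint : Integrable (fun x => ε * |h x|) μ := (hh.abs).const_mul ε
  calc |∫ x, (q x - 1) * h x ∂μ| = ‖∫ x, (q x - 1) * h x ∂μ‖ := (Real.norm_eq_abs _).symm
    _ ≤ ∫ x, ε * |h x| ∂μ := norm_integral_le_of_norm_le hint (Eventually.of_forall hpt)
    _ = ε * ∫ x, |h x| ∂μ := integral_const_mul ε _

end Summit.NavierStokesRegularity.NavierStokesRegularity.Theorems.DefectColumnGate

end
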